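import Literature.Probability.LatticeModels.AnisotropicPlaneRotatorLRO
import Literature.Probability.LatticeModels.NVectorAnisotropicInfraredBound
import HarnessLib

/-!
# The anisotropic infrared-bound floor for the LAYERED plane rotator on `(ℤ/Lℤ)³`
# (Fröhlich–Israel–Lieb–Simon 1978, §4, (4.10) with the anisotropic dispersion)

Topic `Probability/LatticeModels`, namespace `Literature.Probability.LatticeModels.AnisotropicRotator`.
Closes the `TODO(general form)` of `AnisotropicPlaneRotatorLRO.lean`: there the plateau
`L⁻⁶∑_{x,y}⟨cos(θ_x − θ_y)⟩_K` of the classical plane rotator on `(ℤ/Lℤ)³` with direction-dependent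
nearest-neighbour couplings `K = (K₀, K₁, K₂)` was bounded below through Ginibre comparison with
the ISOTROPIC model at the weakest coupling, `plateau ≥ 1 − torusGreen 0 / minᵢ Kᵢ` — a floor that is
linear in the interlayer coupling of the layered model `K = (J∥, J∥, J⊥)`. With the anisotropic
Gaussian domination / infrared bound of `NVectorAnisotropicGaussianDomination.lean` /
`NVectorAnisotropicInfraredBound.lean` (FILS 1978, Thms. 4.6–4.7) the floor becomes the printed
(4.10) with the ANISOTROPIC torus Green function:

* `anisoTorusGreen L K = L⁻³ ∑_{k≠0} E_K(2πk/L)⁻¹`, `E_K(p) = ∑ᵢ Kᵢ(1 − cos pᵢ)`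
  (`NVector.anisoDispersion`); for `K ≡ J` this is `torusGreen 0 / J` (`anisoTorusGreen_const`), and
  `anisoTorusGreen L K ≤ torusGreen 0 / J` whenever `J ≤ Kᵢ` (`anisoTorusGreen_le_of_le`: the new
  floor dominates the old one);
* **`plateau_ge_anisoTorusGreen`**: for `Kᵢ > 0`, every even `L ≥ 4`,
  `L⁻⁶∑_{x,y}⟨cos(θ_x − θ_y)⟩_K ≥ 1 − anisoTorusGreen L K`;
* **`layered_plateau_ge_aniso`**: for `J∥, J⊥ > 0`,
  `plateau L (J∥,J∥,J⊥) ≥ 1 − L⁻³∑_{k≠0} [J∥(2 − cos p₁ − cos p₂) + J⊥(1 − cos p₃)]⁻¹`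
  (Kennedy–Lieb–Shastry's dispersion `E^r_q` with `r = J⊥/J∥`).

The bridge to the `ν = 2` vector model is the one of `PlaneRotatorLROProofs.lean` (uniform law on
the circle as `(cos, sin)_* Leb|_{[0,2π]}`, `‖S_x − S_y‖² = 2 − 2cos(θ_x − θ_y)`), with couplings
`Kᵢ/2` in Friedli–Velenik's normalisation (10.38): `e^{-∑(Kᵢ/2)‖S_{x+eᵢ} − S_x‖²} = e^{-L³∑Kᵢ}·w_K(θ)`.
The thermodynamic limit of `anisoTorusGreen` (a Riemann sum of `E_K⁻¹`, finite in `d = 3`, growing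
like `(2π)⁻¹ log(J∥/J⊥)` for the layered model) is not taken here. Classical comparison model only;
nothing here is a statement about a quantum or fermionic system.

## References

* J. Fröhlich, R. Israel, E. H. Lieb, B. Simon, Comm. Math. Phys. 62 (1978) 1–34, §4, (4.6)–(4.10),
  Thms. 4.6–4.7 (Lieb Selecta pp. 211–212, read) [FILS1978].
* S. Friedli, Y. Velenik, *Statistical Mechanics of Lattice Systems*, CUP (2017), §10.5.1 Example
  10.22, §10.5.2 (10.39)–(10.40), Thm. 10.24 [FriedliVelenikSMLS2017].
* T. Kennedy, E. H. Lieb, B. S. Shastry, J. Stat. Phys. 53 (1988) 1019–1030, eq. (7) [KLS1988JSP].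
-/

noncomputable section

open MeasureTheory Set Finset Filter
open scoped BigOperators Real

namespace Literature.Probability.LatticeModels

namespace AnisotropicRotator

variable {L : ℕ}

/-! ### The anisotropic torus Green function at the origin -/

variable (L) in
/-- **The anisotropic torus Green function at the origin**,
`G_{K,L}(0) = L⁻³ ∑_{k ≠ 0} E_K(2πk/L)⁻¹` with `E_K(p) = ∑ᵢ Kᵢ(1 − cos pᵢ)` — the sum in
Fröhlich–Israel–Lieb–Simon's (4.10) `|Λ|⁻¹∑_{p≠0} 1/2βE_p` (here `ν = 2`, `β ↦ Kᵢ/2`).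
[cite: FILS1978, §4, (4.10)] -/
def anisoTorusGreen [NeZero L] (K : Fin 3 → ℝ) : ℝ :=
  1 / (L : ℝ) ^ 3 * ∑ k ∈ Finset.univ.erase (0 : TorusSite 3 L),
    1 / NVector.anisoDispersion K (latticeMomentum L k)

/-- For a constant coupling vector the anisotropic torus Green function is `torusGreen 0 / J`.
[cite: FILS1978, §4, (4.7) (isotropic case)] -/
theorem anisoTorusGreen_const [NeZero L] (J : ℝ) :
    anisoTorusGreen L (fun _ => J) = torusGreen (0 : TorusSite 3 L) / J := by
  unfold anisoTorusGreen
  simp_rw [NVector.anisoDispersion_const]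
  rw [← PlaneRotator.inv_mul_sum_inv_dispersion_eq_torusGreen, mul_div_assoc, Finset.sum_div]
  congr 1
  refine Finset.sum_congr rfl fun k _ => ?_
  rw [div_div, mul_comm]

/-- **The anisotropic Green function is dominated by the isotropic one at the weakest coupling**:
if `0 < J ≤ Kᵢ` for all `i` then `G_{K,L}(0) ≤ torusGreen 0 / J` (termwise `E_K(p) ≥ J·ε(p)`), so the
floor `1 − G_{K,L}(0)` below improves `plateau_ge_of_le`. [cite: FILS1978, §4, (4.7)] -/
theorem anisoTorusGreen_le_of_le [NeZero L] {K : Fin 3 → ℝ} {J : ℝ} (hJ : 0 < J)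
    (hK : ∀ i, J ≤ K i) :
    anisoTorusGreen L K ≤ torusGreen (0 : TorusSite 3 L) / J := by
  rw [← anisoTorusGreen_const J]
  unfold anisoTorusGreen
  refine mul_le_mul_of_nonneg_left (Finset.sum_le_sum fun k hk => ?_) (by positivity)
  have hk0 : k ≠ 0 := Finset.ne_of_mem_erase hk
  have hpos : 0 < NVector.anisoDispersion (fun _ : Fin 3 => J) (latticeMomentum L k) :=
    NVector.anisoDispersion_latticeMomentum_pos (fun _ => hJ) hk0
  refine one_div_le_one_div_of_le hpos ?_
  rw [NVector.anisoDispersion_const]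
  exact NVector.mul_dispersion_le_anisoDispersion hK _

/-- The anisotropic torus Green function is nonnegative for nonnegative couplings.
[cite: FILS1978, §4, (4.7)] -/
theorem anisoTorusGreen_nonneg [NeZero L] {K : Fin 3 → ℝ} (hK : ∀ i, 0 ≤ K i) :
    0 ≤ anisoTorusGreen L K := by
  unfold anisoTorusGreen
  refine mul_nonneg (by positivity) (Finset.sum_nonneg fun k _ => ?_)
  exact div_nonneg zero_le_one (NVector.anisoDispersion_nonneg hK _)

/-! ### The bridge to the `ν = 2` vector model with couplings `Kᵢ/2` -/

/-- **Example 10.22 with a coupling per direction**: for `S_x = (cos θ_x, sin θ_x)`,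
`ℋ_{K/2}(S(θ)) = L³∑ᵢKᵢ − ∑_{(x,i)} Kᵢ cos(θ_{x+eᵢ} − θ_x)`.
[cite: FriedliVelenikSMLS2017, §10.5.1 Example 10.22] -/
theorem nVectorHamiltonianK_cosSin [NeZero L] (K : Fin 3 → ℝ) (θ : TorusSite 3 L → ℝ) :
    NVector.nVectorHamiltonianK (fun i => K i / 2)
        (fun x => (![Real.cos (θ x), Real.sin (θ x)] : Fin 2 → ℝ)) =
      (L : ℝ) ^ 3 * ∑ i : Fin 3, K i -
        ∑ b : TorusSite 3 L × Fin 3, K b.2 * Real.cos (θ (b.1 + Pi.single b.2 1) - θ b.1) := by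
  unfold NVector.nVectorHamiltonianK
  simp_rw [PlaneRotator.sum_cosSin_sub_sq]
  rw [Fintype.sum_prod_type]
  dsimp only
  have h : ∀ x : TorusSite 3 L, ∑ i : Fin 3, K i / 2 * (2 - 2 * Real.cos (θ (x + Pi.single i 1) - θ x)) =
      ∑ i : Fin 3, K i - ∑ i : Fin 3, K i * Real.cos (θ (x + Pi.single i 1) - θ x) := by
    intro x
    rw [← Finset.sum_sub_distrib]
    exact Finset.sum_congr rfl fun i _ => by ring
  simp_rw [h]
  rw [Finset.sum_sub_distrib, Finset.sum_const, Finset.card_univ, nsmul_eq_mul,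
    NVector.card_torusSite_real]

/-- **The Gibbs expectation of `‖m_L‖²` in the anisotropic vector model with couplings `Kᵢ/2` and
the uniform law on the circle is the plateau `L⁻⁶∑_{x,y}⟨cos(θ_x − θ_y)⟩_K`** of the angle-form plane
rotator (the constant `e^{-L³∑Kᵢ}` cancels in the ratio). [cite: FriedliVelenikSMLS2017, §10.5.1 Example 10.22 and (10.39)] -/
theorem integral_magnetisationNormSq_nVectorGibbsK_cosSin [NeZero L] {K : Fin 3 → ℝ}
    (hK : ∀ i, 0 ≤ K i) :
    ∫ ω, magnetisationNormSq ω ∂(NVector.nVectorGibbsK (d := 3) (L := L)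
        (Measure.map (fun t : ℝ => (![Real.cos t, Real.sin t] : Fin 2 → ℝ))
          (volume.restrict (Set.Icc (0 : ℝ) (2 * π)))) (fun i => K i / 2)) = plateau L K := by
  have hK2 : ∀ i, 0 ≤ K i / 2 := fun i => div_nonneg (hK i) zero_le_two
  set w : (TorusSite 3 L → ℝ) → ℝ := weight K with hw
  have hwc : Continuous w := by
    rw [hw]
    unfold weight
    fun_prop
  set a : ℝ := Real.exp (-((L : ℝ) ^ 3 * ∑ i : Fin 3, K i)) with ha
  have ha0 : a ≠ 0 := (Real.exp_pos _).ne'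
  have hexp : ∀ θ : TorusSite 3 L → ℝ, Real.exp (-NVector.nVectorHamiltonianK (fun i => K i / 2)
      (fun x => (![Real.cos (θ x), Real.sin (θ x)] : Fin 2 → ℝ))) = a * w θ := by
    intro θ
    rw [nVectorHamiltonianK_cosSin, ha, hw, weight, ← Real.exp_add]
    congr 1
    ring
  have h1 : Continuous fun ω : VecConfig 3 L 2 =>
      Real.exp (-NVector.nVectorHamiltonianK (fun i => K i / 2) ω) * magnetisationNormSq ω :=
    (NVector.continuous_nVectorHamiltonianK _).neg.rexp.mul NVector.continuous_magnetisationNormSq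
  have h2 : Continuous fun ω : VecConfig 3 L 2 =>
      Real.exp (-NVector.nVectorHamiltonianK (fun i => K i / 2) ω) :=
    (NVector.continuous_nVectorHamiltonianK _).neg.rexp
  rw [NVector.integral_nVectorGibbsK _
      (PlaneRotator.map_angleLaw_ne_zero PlaneRotator.continuous_cosSin.measurable) hK2,
    NVector.nVectorPartitionFunctionK,
    PlaneRotator.integral_nVectorRef_map_angleLaw PlaneRotator.continuous_cosSin _ h1,
    PlaneRotator.integral_nVectorRef_map_angleLaw PlaneRotator.continuous_cosSin _ h2]
  simp_rw [hexp, PlaneRotator.magnetisationNormSq_cosSin]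
  have hpt : ∀ θ : TorusSite 3 L → ℝ,
      a * w θ * ((∑ x, ∑ y, Real.cos (θ x - θ y)) / (L : ℝ) ^ 6) =
        a * ((∑ x, ∑ y, Real.cos (θ x - θ y) * w θ) / (L : ℝ) ^ 6) := by
    intro θ
    simp_rw [← Finset.sum_mul]
    ring
  simp_rw [hpt]
  have hint : ∀ x y : TorusSite 3 L,
      Integrable (fun θ : TorusSite 3 L → ℝ => Real.cos (θ x - θ y) * w θ)
        (volume.restrict (Set.pi Set.univ fun _ => Set.Icc (0 : ℝ) (2 * π))) := fun x y =>
    PlaneRotator.integrableOn_angleCube (by fun_prop)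
  rw [integral_const_mul, integral_div, integral_const_mul,
    integral_finsetSum _ fun x _ => integrable_finsetSum _ fun y _ => hint x y]
  rw [mul_div_mul_left _ _ ha0, div_div, mul_comm ((L : ℝ) ^ 6), ← div_div]
  unfold plateau corr
  congr 1
  rw [Finset.sum_div]
  refine Finset.sum_congr rfl fun x _ => ?_
  rw [integral_finsetSum _ fun y _ => hint x y, Finset.sum_div]

/-! ### The anisotropic floor -/

/-- `E_{K/2}(p) = E_K(p)/2`. [cite: FILS1978, §4, (4.7)] -/
theorem anisoDispersion_half (K : Fin 3 → ℝ) (p : Fin 3 → ℝ) :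
    NVector.anisoDispersion (fun i => K i / 2) p = NVector.anisoDispersion K p / 2 := by
  unfold NVector.anisoDispersion
  rw [Finset.sum_div]
  exact Finset.sum_congr rfl fun i _ => by ring

variable (L) in
/-- **The anisotropic infrared-bound floor, finite volume** (Fröhlich–Israel–Lieb–Simon 1978, §4,
(4.10) with Thm. 4.7's `E_p = ∑ᵢKᵢ(1 − cos pᵢ)`; Friedli–Velenik 2017, display after Thm. 10.24 with
`ν = 2`): for the plane rotator on `(ℤ/Lℤ)³` with direction-dependent couplings `Kᵢ > 0`, `L` even,
`L ≥ 4`, `L⁻⁶∑_{x,y}⟨cos(θ_x − θ_y)⟩_K ≥ 1 − L⁻³∑_{k≠0} E_K(2πk/L)⁻¹`.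
[cite: FILS1978, §4, (4.10) and Thm. 4.7] -/
theorem plateau_ge_anisoTorusGreen [NeZero L] (hLe : Even L) (hL4 : 4 ≤ L) {K : Fin 3 → ℝ}
    (hK : ∀ i, 0 < K i) :
    1 - anisoTorusGreen L K ≤ plateau L K := by
  have hK2 : ∀ i, 0 ≤ K i / 2 := fun i => (half_pos (hK i)).le
  have hK2' : ∀ i, 0 < K i / 2 := fun i => half_pos (hK i)
  obtain ⟨S, hSc, hS⟩ := PlaneRotator.exists_isCompact_map_angleLaw
    (ν := 2) PlaneRotator.continuous_cosSin
  have hfact := (NVector.nVectorK_infraredBound (d := 3) (ν := 2) hLe hL4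
    (Measure.map (fun t : ℝ => (![Real.cos t, Real.sin t] : Fin 2 → ℝ))
      (volume.restrict (Set.Icc (0 : ℝ) (2 * π)))) hSc hS
    (PlaneRotator.map_angleLaw_ne_zero PlaneRotator.continuous_cosSin.measurable) hK2).2 hK2'
    (PlaneRotator.ae_map_angleLaw PlaneRotator.continuous_cosSin PlaneRotator.sum_cosSin_sq)
  rw [integral_magnetisationNormSq_nVectorGibbsK_cosSin (fun i => (hK i).le)] at hfact
  have hcoef : ((2 : ℕ) : ℝ) / 4 * ((1 / (L : ℝ) ^ 3) *
      ∑ k ∈ Finset.univ.erase (0 : TorusSite 3 L),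
        1 / NVector.anisoDispersion (fun i => K i / 2) (latticeMomentum L k)) =
      anisoTorusGreen L K := by
    unfold anisoTorusGreen
    simp_rw [anisoDispersion_half]
    rw [← mul_assoc, mul_comm (((2 : ℕ) : ℝ) / 4), mul_assoc, Finset.mul_sum]
    congr 1
    refine Finset.sum_congr rfl fun k _ => ?_
    push_cast
    field_simp
    ring
  rw [hcoef] at hfact
  exact hfact

/-- Every component of the layered coupling vector is positive when `J∥, J⊥ > 0`. [folklore] -/
private theorem layeredCoupling_pos {Jpar Jperp : ℝ} (hpar : 0 < Jpar) (hperp : 0 < Jperp)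
    (i : Fin 3) : 0 < layeredCoupling Jpar Jperp i := by
  unfold layeredCoupling
  split_ifs
  · exact hperp
  · exact hpar

variable (L) in
/-- **The layered model, finite volume, anisotropic floor**: for in-plane coupling `J∥ > 0` and
interlayer coupling `J⊥ > 0`, on every even torus `(ℤ/Lℤ)³`, `L ≥ 4`, the classical layered XY model
has `L⁻⁶∑_{x,y}⟨cos(θ_x − θ_y)⟩_{(J∥,J∥,J⊥)} ≥ 1 − L⁻³∑_{k≠0}[J∥(2 − cos p₁ − cos p₂) + J⊥(1 − cos p₃)]⁻¹`
(Kennedy–Lieb–Shastry's layered dispersion). For `J⊥ ≤ J∥` the right-hand side is at least the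
weakest-coupling floor `1 − torusGreen 0 / J⊥` of `layered_plateau_ge` (`anisoTorusGreen_le_of_le`).
[cite: FILS1978, §4, (4.10) and Thm. 4.7] [cite: KLS1988JSP, eq. (7)] -/
theorem layered_plateau_ge_aniso [NeZero L] (hLe : Even L) (hL4 : 4 ≤ L) {Jpar Jperp : ℝ}
    (hpar : 0 < Jpar) (hperp : 0 < Jperp) :
    1 - anisoTorusGreen L (layeredCoupling Jpar Jperp) ≤ plateau L (layeredCoupling Jpar Jperp) :=
  plateau_ge_anisoTorusGreen L hLe hL4 (layeredCoupling_pos hpar hperp)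

/-- The layered anisotropic Green function written out with Kennedy–Lieb–Shastry's dispersion:
`anisoTorusGreen L (J∥,J∥,J⊥) = L⁻³∑_{k≠0}[J∥(1 − cos p₀) + J∥(1 − cos p₁) + J⊥(1 − cos p₂)]⁻¹`.
[cite: KLS1988JSP, eq. (7)] -/
theorem anisoTorusGreen_layered [NeZero L] (Jpar Jperp : ℝ) :
    anisoTorusGreen L (layeredCoupling Jpar Jperp) =
      1 / (L : ℝ) ^ 3 * ∑ k ∈ Finset.univ.erase (0 : TorusSite 3 L),
        1 / (Jpar * (1 - Real.cos (latticeMomentum L k 0)) +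
          Jpar * (1 - Real.cos (latticeMomentum L k 1)) +
            Jperp * (1 - Real.cos (latticeMomentum L k 2))) := by
  unfold anisoTorusGreen NVector.anisoDispersion layeredCoupling
  congr 1
  refine Finset.sum_congr rfl fun k _ => ?_
  simp [Fin.sum_univ_three]

end AnisotropicRotator

end Literature.Probability.LatticeModels
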